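import Mathlib
import Literature.AlgebraicGeometry.Resolution.CobordantChartCoefficients
import Literature.AlgebraicGeometry.Resolution.AxisPolyhedron
import Summits.ResolutionOfSingularities.ResolutionOfSingularities.Theorems.WeightedInvariantLocalWeightedDropAxisPreparationAux
import Summits.ResolutionOfSingularities.ResolutionOfSingularities.Theorems.WeightedInvariantLocalWeightedDropAxisPreparationShear

/-!
# `WeightedInvariant.LocalWeightedDrop`, line `hasse-ridge-face-selection`: the axis preparation (B1)

Crux item stmt-ResolutionOfSingularities-8899 (route `ResolutionOfSingularities/WeightedInvariant`), skeleton v18/v19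
of the line `hasse-ridge-face-selection`, registered stub `stub_axisPreparation`, PROVED here (statement verbatim):
HIRONAKA'S VERTEX DISSOLUTION WITH ONE FREE VARIABLE, over every field.  For `g ∈ k[[x'₁, …, x'ₙ, z]]` of order `d`
whose degree-`d` part involves no `z` (`AxisCone`) and has trivial apex inside `z = 0` (`TrivialApexX`), some shear
`x' ↦ x' - ψ(z)` by a vector `ψ` of series in `z` alone without constant and linear terms makes `g` either
EQUIMULTIPLE ALONG THE AXIS (`InAxisIdeal`: `g ∈ (x')^d`) or PREPARED (`PreparedAxis`: no non-zero vector solves the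
vertex of the polyhedron `Δ(g; x'; z) ⊂ ℝ` at any integer level).

Proof (the shear loop).  While the current series `h` is not prepared, pick a level `M` and a vector `lam ≠ 0`
solving its vertex and replace `h` by its shear `x' ↦ x' - lam z^M`.  By `…AxisPreparationShear`:
`M ≥ 2` (`two_le_of_solvable`), so the shear is tangent to the identity and the order, `AxisCone` and `TrivialApexX`
persist (`…AxisPreparationAux`); after the shear every coefficient `x'^a z^c`, `|a| < d`, `c ≤ M (d - |a|)` vanishes
(`coeff_subst_shearFam_eq_zero_of_solvable`), while a solving vector at the next level `M'` witnesses a non-zero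
coefficient on the line of level `M'` (`exists_coeff_ne_zero_of_solvable`) — so the levels STRICTLY INCREASE
(`M_i ≥ i + 2`).  If the loop stops, the accumulated (polynomial) shear vector prepares `g`.  Otherwise the shear
vectors converge `z`-adically (the `i`-th increment is `lam_i z^{M_i}`, `M_i > i`); the limit `ψ∞` differs from the
`m`-th partial sum by a `z`-only vector `ρ` without terms below `z^{M_m}`, so `g∘shear_{ψ∞} = (g_m)∘shear_ρ` with
`g_m` above the level `M_m` and `shear_ρ` of weighted orders `≥ (M_m, …, M_m, 1)`: every coefficient of weight
`< M_m d` of `g∘shear_{ψ∞}` vanishes (`coeff_subst_eq_zero_of_weight_lt`), and `M_m > m` is arbitrary — `g∘shear_{ψ∞} ∈ (x')^d`.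
All auxiliary objects (choice of levels and vectors, the sequence, the limit) are local to the proof (no definitions).
-/

set_option linter.dupNamespace false -- mandated namespace of this single-conjunct summit

namespace Summit.ResolutionOfSingularities.ResolutionOfSingularities.Theorems

open Literature.AlgebraicGeometry.Resolution

namespace AxisPreparation

open MvPowerSeries AxisPolyhedron

variable {k : Type} [Field k] {n : ℕ}

/-! ### More on `z`-only series and shears -/

/-- Negatives of `z`-only series are `z`-only. -/
theorem IsZOnly.neg {φ : MvPowerSeries (Fin (n + 1)) k} (hφ : IsZOnly φ) : IsZOnly (-φ) :=
  fun E hE => hφ E (by rwa [map_neg, neg_ne_zero] at hE)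

/-- Differences of `z`-only series are `z`-only. -/
theorem IsZOnly.sub {φ ψ : MvPowerSeries (Fin (n + 1)) k} (hφ : IsZOnly φ) (hψ : IsZOnly ψ) :
    IsZOnly (φ - ψ) := by
  rw [sub_eq_add_neg]
  exact IsZOnly.add hφ (IsZOnly.neg hψ)

/-- The trivial shear is the identity substitution. -/
theorem subst_shearFam_zero (h : MvPowerSeries (Fin (n + 1)) k) :
    subst (shearFam (0 : Fin n → MvPowerSeries (Fin (n + 1)) k)) h = h := by
  have hX : shearFam (0 : Fin n → MvPowerSeries (Fin (n + 1)) k) = X := by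
    funext l
    rcases Fin.eq_castSucc_or_eq_last l with ⟨j, rfl⟩ | rfl
    · rw [shearFam_castSucc, Pi.zero_apply, sub_zero]
    · rw [shearFam_last]
  rw [hX]
  exact congrFun subst_self h

/-- WEIGHTED ORDERS OF A DEEP SHEAR: if `ρ` is `z`-only without terms below `z^M`, the shear family `x'_j - ρ_j`, `z`
has weighted orders `≥ (M, …, M, 1)`. -/
theorem weight_le_weightedOrder_shearFam {ρ : Fin n → MvPowerSeries (Fin (n + 1)) k} (hz : ∀ j, IsZOnly (ρ j))
    {M : ℕ} (hM : ∀ (j : Fin n) (E : Fin (n + 1) →₀ ℕ), E (Fin.last n) < M → coeff E (ρ j) = 0)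
    (l : Fin (n + 1)) :
    (((Fin.snoc (fun _ : Fin n => M) 1 : Fin (n + 1) → ℕ) l : ℕ) : ℕ∞) ≤
      (shearFam ρ l).weightedOrder (Fin.snoc (fun _ : Fin n => M) 1 : Fin (n + 1) → ℕ) := by
  classical
  apply nat_le_weightedOrder
  intro D hD
  rw [weight_snoc] at hD
  rcases Fin.eq_castSucc_or_eq_last l with ⟨j, rfl⟩ | rfl
  · rw [Fin.snoc_castSucc] at hD
    rw [shearFam_castSucc, map_sub, coeff_X]
    have h1 : D ≠ Finsupp.single (Fin.castSucc j) 1 := by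
      rintro rfl
      rw [xDeg_single_castSucc, Finsupp.single_eq_of_ne (Fin.castSucc_lt_last j).ne'] at hD
      omega
    rw [if_neg h1, zero_sub, neg_eq_zero]
    by_cases hx : xDeg D = 0
    · rw [hx, mul_zero, zero_add] at hD
      exact hM j D hD
    · by_contra hne
      exact hx (hz j D hne)
  · rw [Fin.snoc_last] at hD
    rw [shearFam_last, coeff_X]
    have h1 : D ≠ Finsupp.single (Fin.last n) 1 := by
      rintro rfl
      rw [xDeg_single_last, Finsupp.single_eq_same] at hD
      omega
    rw [if_neg h1]

end AxisPreparation

open AxisPreparation AxisPolyhedron MvPowerSeries in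
/-- B1 — PREPARATION ALONG THE AXIS (Hironaka's vertex dissolution with one free variable; every field), registered
stub `stub_axisPreparation` of the line `hasse-ridge-face-selection` of crux `LocalWeightedDrop`
(stmt-ResolutionOfSingularities-8899).  For `g` of order `d` whose degree-`d` part involves no `z` and has trivial apex
inside `z = 0`, some shear `x' ↦ x' - ψ(z)` (`ψ` a vector of series in `z` alone without constant and linear terms;
legal, linear part the identity) makes `g` EITHER equimultiple along the axis (`InAxisIdeal`) OR prepared
(`PreparedAxis`); the order, `AxisCone` and `TrivialApexX` are unchanged.  Proof: the shear loop of the module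
docstring (finite: prepared; infinite: `z`-adic limit, equimultiple). -/
theorem stub_axisPreparation : ∀ (k : Type) [Field k] (n d : ℕ) (g : MvPowerSeries (Fin (n + 1)) k),
    g.order = d → AxisPolyhedron.AxisCone d g → AxisPolyhedron.TrivialApexX d g →
    ∃ ψ : Fin n → MvPowerSeries (Fin (n + 1)) k,
      (∀ j, AxisPolyhedron.IsZOnly (ψ j) ∧ MvPowerSeries.constantCoeff (ψ j) = 0 ∧
        MvPowerSeries.coeff (Finsupp.single (Fin.last n) 1) (ψ j) = 0) ∧
      (∀ i, MvPowerSeries.constantCoeff (AxisPolyhedron.shearFam ψ i) = 0) ∧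
      IsUnit (Matrix.det (Matrix.of fun i j =>
        MvPowerSeries.coeff (Finsupp.single j 1) (AxisPolyhedron.shearFam ψ i))) ∧
      (MvPowerSeries.subst (AxisPolyhedron.shearFam ψ) g).order = d ∧
      AxisPolyhedron.AxisCone d (MvPowerSeries.subst (AxisPolyhedron.shearFam ψ) g) ∧
      AxisPolyhedron.TrivialApexX d (MvPowerSeries.subst (AxisPolyhedron.shearFam ψ) g) ∧
      (AxisPolyhedron.InAxisIdeal d (MvPowerSeries.subst (AxisPolyhedron.shearFam ψ) g) ∨
        (¬ AxisPolyhedron.InAxisIdeal d (MvPowerSeries.subst (AxisPolyhedron.shearFam ψ) g) ∧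
          AxisPolyhedron.PreparedAxis d (MvPowerSeries.subst (AxisPolyhedron.shearFam ψ) g))) := by
  intro k _ n d g hgd hcone hapex
  classical
  -- it suffices to find a good shear vector making `g` equimultiple or prepared
  suffices main : ∃ ψ : Fin n → MvPowerSeries (Fin (n + 1)) k,
      (∀ j, IsZOnly (ψ j) ∧ constantCoeff (ψ j) = 0 ∧ coeff (Finsupp.single (Fin.last n) 1) (ψ j) = 0) ∧
      (InAxisIdeal d (subst (shearFam ψ) g) ∨ PreparedAxis d (subst (shearFam ψ) g)) by
    obtain ⟨ψ, hψ, hcase⟩ := main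
    have hz : ∀ j, IsZOnly (ψ j) := fun j => (hψ j).1
    have h0 : ∀ j, constantCoeff (ψ j) = 0 := fun j => (hψ j).2.1
    have h1 : ∀ j, coeff (Finsupp.single (Fin.last n) 1) (ψ j) = 0 := fun j => (hψ j).2.2
    have hco : ∀ E : Fin (n + 1) →₀ ℕ, E.degree ≤ d → coeff E (subst (shearFam ψ) g) = coeff E g :=
      fun E hE => coeff_subst_shearFam_of_degree_le hz h0 h1 g (by rw [hgd]; exact_mod_cast hE)
    obtain ⟨hord, hc, ha⟩ := order_axisCone_trivialApexX_of_coeff_eq hco hgd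
    refine ⟨ψ, hψ, constantCoeff_shearFam h0, isUnit_det_shearFam hz h1, hord, hc hcone, ha hapex, ?_⟩
    rcases hcase with hin | hprep
    · exact Or.inl hin
    · by_cases hin : InAxisIdeal d (subst (shearFam ψ) g)
      · exact Or.inl hin
      · exact Or.inr ⟨hin, hprep⟩
  -- an unprepared series has a solving pair (level, non-zero vector)
  have hunp : ∀ h : MvPowerSeries (Fin (n + 1)) k, ¬ PreparedAxis d h →
      ∃ q : ℕ × (Fin n → k), q.2 ≠ 0 ∧ Solvable d q.1 q.2 h := by
    intro h hh
    unfold PreparedAxis at hh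
    push Not at hh
    obtain ⟨M, lam, hlam, hsol⟩ := hh
    exact ⟨(M, lam), hlam, hsol⟩
  -- choice functions: the level and the vector of one dissolution step (`0` at a prepared series)
  obtain ⟨lev, lamv, hch, hpr⟩ : ∃ (lev : MvPowerSeries (Fin (n + 1)) k → ℕ)
      (lamv : MvPowerSeries (Fin (n + 1)) k → Fin n → k),
      (∀ h, ¬ PreparedAxis d h → lamv h ≠ 0 ∧ Solvable d (lev h) (lamv h) h) ∧
      (∀ h, PreparedAxis d h → lev h = 0 ∧ lamv h = 0) := by
    refine ⟨fun h => if hh : PreparedAxis d h then 0 else ((hunp h hh).choose).1,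
      fun h => if hh : PreparedAxis d h then 0 else ((hunp h hh).choose).2, ?_, ?_⟩
    · intro h hh
      simp only [dif_neg hh]
      exact (hunp h hh).choose_spec
    · intro h hh
      simp only [dif_pos hh, and_self]
  -- the increment `lamv h · z^{lev h}`, one step, the sequence of series and of accumulated shear vectors
  obtain ⟨incr, hincr⟩ : ∃ incr : MvPowerSeries (Fin (n + 1)) k → Fin n → MvPowerSeries (Fin (n + 1)) k,
      ∀ h, incr h = fun j => C (lamv h j) * X (Fin.last n) ^ (lev h) := ⟨_, fun _ => rfl⟩
  obtain ⟨step, hstep⟩ : ∃ step : MvPowerSeries (Fin (n + 1)) k → MvPowerSeries (Fin (n + 1)) k,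
      ∀ h, step h = subst (shearFam (incr h)) h := ⟨_, fun _ => rfl⟩
  obtain ⟨gs, hgs0, hgs⟩ : ∃ gs : ℕ → MvPowerSeries (Fin (n + 1)) k,
      gs 0 = g ∧ ∀ i, gs (i + 1) = step (gs i) :=
    ⟨fun i => step^[i] g, rfl, fun i => Function.iterate_succ_apply' step i g⟩
  obtain ⟨ψs, hψs⟩ : ∃ ψs : ℕ → Fin n → MvPowerSeries (Fin (n + 1)) k,
      ∀ i, ψs i = ∑ i' ∈ Finset.range i, incr (gs i') := ⟨_, fun _ => rfl⟩
  have hψsucc : ∀ i, ψs (i + 1) = ψs i + incr (gs i) := fun i => by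
    rw [hψs, hψs, Finset.sum_range_succ]
  -- the increment at a series satisfying the invariant is `z`-only without constant and linear terms
  have hincr_good : ∀ h : MvPowerSeries (Fin (n + 1)) k, h.order = d → AxisCone d h → TrivialApexX d h →
      ∀ j, IsZOnly (incr h j) ∧ constantCoeff (incr h j) = 0 ∧
        coeff (Finsupp.single (Fin.last n) 1) (incr h j) = 0 := by
    intro h hd hc ha j
    have hj : incr h j = C (lamv h j) * X (Fin.last n) ^ (lev h) := by rw [hincr]
    rw [hj]
    by_cases hp : PreparedAxis d h
    · obtain ⟨-, hl0⟩ := hpr h hp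
      rw [hl0, Pi.zero_apply, map_zero, zero_mul]
      exact ⟨isZOnly_zero, map_zero _, map_zero _⟩
    · obtain ⟨hlam, hsol⟩ := hch h hp
      have h2 := two_le_of_solvable hd hc ha hlam hsol
      exact ⟨isZOnly_C_mul_X_pow _ _, constantCoeff_C_mul_X_pow _ (by omega),
        coeff_single_C_mul_X_pow _ (by omega)⟩
  -- THE INVARIANT along the sequence
  have hinv : ∀ i, ((gs i).order = d ∧ AxisCone d (gs i) ∧ TrivialApexX d (gs i)) ∧
      (∀ j, IsZOnly (ψs i j) ∧ constantCoeff (ψs i j) = 0 ∧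
        coeff (Finsupp.single (Fin.last n) 1) (ψs i j) = 0) ∧
      gs i = subst (shearFam (ψs i)) g := by
    intro i
    induction i with
    | zero =>
      refine ⟨?_, ?_, ?_⟩
      · rw [hgs0]
        exact ⟨hgd, hcone, hapex⟩
      · intro j
        rw [hψs, Finset.sum_range_zero, Pi.zero_apply]
        exact ⟨isZOnly_zero, map_zero _, map_zero _⟩
      · rw [hψs, Finset.sum_range_zero, subst_shearFam_zero, hgs0]
    | succ i ih =>
      obtain ⟨⟨hd, hc, ha⟩, hψ, hgi⟩ := ih
      have hI := hincr_good (gs i) hd hc ha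
      have hz : ∀ j, IsZOnly (incr (gs i) j) := fun j => (hI j).1
      have h0 : ∀ j, constantCoeff (incr (gs i) j) = 0 := fun j => (hI j).2.1
      have h1 : ∀ j, coeff (Finsupp.single (Fin.last n) 1) (incr (gs i) j) = 0 := fun j => (hI j).2.2
      have hco : ∀ E : Fin (n + 1) →₀ ℕ, E.degree ≤ d → coeff E (gs (i + 1)) = coeff E (gs i) := by
        intro E hE
        rw [hgs, hstep]
        exact coeff_subst_shearFam_of_degree_le hz h0 h1 (gs i) (by rw [hd]; exact_mod_cast hE)
      obtain ⟨hord, hc', ha'⟩ := order_axisCone_trivialApexX_of_coeff_eq hco hd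
      refine ⟨⟨hord, hc' hc, ha' ha⟩, ?_, ?_⟩
      · intro j
        rw [hψsucc, Pi.add_apply]
        exact ⟨IsZOnly.add (hψ j).1 (hz j), by rw [map_add, (hψ j).2.1, h0 j, add_zero],
          by rw [map_add, (hψ j).2.2, h1 j, add_zero]⟩
      · rw [hgs, hstep, hψsucc, ← subst_shearFam_shearFam h0 (fun j => (hψ j).2.1) (fun j => (hψ j).1) g,
          ← hgi]
  -- FINITE CASE: some stage is prepared
  by_cases hfin : ∃ i, PreparedAxis d (gs i)
  · obtain ⟨i, hi⟩ := hfin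
    obtain ⟨-, hψ, hgi⟩ := hinv i
    exact ⟨ψs i, hψ, Or.inr (by rw [← hgi]; exact hi)⟩
  -- INFINITE CASE: every stage is dissolved; the levels strictly increase
  push Not at hfin
  have hsol : ∀ i, lamv (gs i) ≠ 0 ∧ Solvable d (lev (gs i)) (lamv (gs i)) (gs i) := fun i => hch _ (hfin i)
  have hlt : ∀ i, lev (gs i) < lev (gs (i + 1)) := by
    intro i
    obtain ⟨⟨hd1, hc1, ha1⟩, -, -⟩ := hinv (i + 1)
    obtain ⟨hlam1, hsol1⟩ := hsol (i + 1)
    obtain ⟨E, hEx, hEl, hEne⟩ := exists_coeff_ne_zero_of_solvable ha1 hlam1 hsol1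
    obtain ⟨⟨hd0, hc0, ha0⟩, -, -⟩ := hinv i
    obtain ⟨hlam0, hsol0⟩ := hsol i
    have hM0 : 1 ≤ lev (gs i) := le_trans (by norm_num) (two_le_of_solvable hd0 hc0 ha0 hlam0 hsol0)
    by_contra hle
    push Not at hle
    apply hEne
    rw [hgs, hstep, hincr]
    refine coeff_subst_shearFam_eq_zero_of_solvable hM0 hsol0 hEx ?_
    rw [hEl]
    exact Nat.mul_le_mul_right _ hle
  have hmono : StrictMono (fun i => lev (gs i)) := strictMono_nat_of_lt_succ hlt
  have hge : ∀ i, i + 2 ≤ lev (gs i) := by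
    intro i
    induction i with
    | zero =>
      obtain ⟨⟨hd0, hc0, ha0⟩, -, -⟩ := hinv 0
      exact two_le_of_solvable hd0 hc0 ha0 (hsol 0).1 (hsol 0).2
    | succ i ih =>
      have := hlt i
      omega
  -- coefficients of the increments
  have hincr_zero : ∀ (i : ℕ) (j : Fin n) (E : Fin (n + 1) →₀ ℕ), E (Fin.last n) ≠ lev (gs i) →
      coeff E (incr (gs i) j) = 0 := by
    intro i j E hE
    rw [hincr]
    simp only [coeff_C_mul, coeff_X_pow]
    rw [if_neg, mul_zero]
    rintro rfl
    exact hE Finsupp.single_eq_same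
  -- THE `z`-ADIC LIMIT of the accumulated shear vectors
  obtain ⟨ψinf, hψinf⟩ : ∃ ψinf : Fin n → MvPowerSeries (Fin (n + 1)) k,
      ∀ (j : Fin n) (E : Fin (n + 1) →₀ ℕ),
        coeff E (ψinf j) = ∑ i ∈ Finset.range (E (Fin.last n)), coeff E (incr (gs i) j) :=
    ⟨fun j E => ∑ i ∈ Finset.range (E (Fin.last n)), coeff E (incr (gs i) j), fun _ _ => rfl⟩
  have hψinf_good : ∀ j, IsZOnly (ψinf j) ∧ constantCoeff (ψinf j) = 0 ∧
      coeff (Finsupp.single (Fin.last n) 1) (ψinf j) = 0 := by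
    intro j
    refine ⟨?_, ?_, ?_⟩
    · intro E hE
      rw [hψinf] at hE
      obtain ⟨i, -, hi⟩ := Finset.exists_ne_zero_of_sum_ne_zero hE
      obtain ⟨⟨hd, hc, ha⟩, -, -⟩ := hinv i
      exact (hincr_good (gs i) hd hc ha j).1 E hi
    · rw [← coeff_zero_eq_constantCoeff_apply, hψinf, Finsupp.coe_zero, Pi.zero_apply, Finset.sum_range_zero]
    · rw [hψinf, Finsupp.single_eq_same, Finset.sum_range_one]
      obtain ⟨⟨hd, hc, ha⟩, -, -⟩ := hinv 0
      exact (hincr_good (gs 0) hd hc ha j).2.2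
  -- the limit minus the `m`-th partial sum has no terms below `z^{M_m}`
  have htail : ∀ (m : ℕ) (j : Fin n) (E : Fin (n + 1) →₀ ℕ), E (Fin.last n) < lev (gs m) →
      coeff E (ψinf j - ψs m j) = 0 := by
    intro m j E hE
    rw [map_sub, sub_eq_zero, hψinf, hψs, Finset.sum_apply, map_sum]
    have hvan : ∀ i, E (Fin.last n) ≤ i ∨ m ≤ i → coeff E (incr (gs i) j) = 0 := by
      intro i hi
      apply hincr_zero
      rcases hi with hi | hi
      · have := hge i
        omega
      · have h' : lev (gs m) ≤ lev (gs i) := hmono.monotone hi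
        omega
    rw [Finset.sum_subset (Finset.range_mono (le_max_left (E (Fin.last n)) m)) fun i _ hi' =>
        hvan i (Or.inl (by rw [Finset.mem_range, not_lt] at hi'; exact hi')),
      Finset.sum_subset (Finset.range_mono (le_max_right (E (Fin.last n)) m)) fun i _ hi' =>
        hvan i (Or.inr (by rw [Finset.mem_range, not_lt] at hi'; exact hi'))]
  -- the limit shear makes `g` equimultiple along the axis
  refine ⟨ψinf, hψinf_good, Or.inl ?_⟩
  intro E hEx
  obtain ⟨m, hm⟩ : ∃ m : ℕ, m = E (Fin.last n) := ⟨_, rfl⟩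
  obtain ⟨-, hψm, hgm⟩ := hinv m
  obtain ⟨-, hsolm⟩ := hsol m
  obtain ⟨habove, -⟩ : AboveLevel d (lev (gs m)) 1 (gs m) ∧ _ := hsolm
  have hMm : m < lev (gs m) := by
    have := hge m
    omega
  have hsplit : ψinf = ψs m + (ψinf - ψs m) := by abel
  have hρ0 : ∀ j, constantCoeff ((ψinf - ψs m) j) = 0 := fun j => by
    rw [Pi.sub_apply, map_sub, (hψinf_good j).2.1, (hψm j).2.1, sub_zero]
  have hρz : ∀ j, IsZOnly ((ψinf - ψs m) j) := fun j => by
    rw [Pi.sub_apply]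
    exact IsZOnly.sub (hψinf_good j).1 (hψm j).1
  have hρM : ∀ (j : Fin n) (E' : Fin (n + 1) →₀ ℕ), E' (Fin.last n) < lev (gs m) →
      coeff E' ((ψinf - ψs m) j) = 0 := fun j E' hE' => by
    rw [Pi.sub_apply]
    exact htail m j E' hE'
  rw [hsplit, ← subst_shearFam_shearFam hρ0 (fun j => (hψm j).2.1) (fun j => (hψm j).1) g, ← hgm]
  refine coeff_subst_eq_zero_of_weight_lt (Fin.snoc (fun _ : Fin n => lev (gs m)) 1 : Fin (n + 1) → ℕ)
    (constantCoeff_shearFam hρ0) (weight_le_weightedOrder_shearFam hρz hρM) (N := lev (gs m) * d) ?_ E ?_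
  · intro B hB
    rw [weight_snoc] at hB
    obtain ⟨hBx, hBl⟩ := weight_lt_iff.mp hB
    exact habove B hBx (by rw [one_mul]; exact hBl)
  · rw [weight_snoc, weight_lt_iff]
    refine ⟨hEx, ?_⟩
    rw [← hm]
    exact lt_of_lt_of_le hMm (Nat.le_mul_of_pos_right _ (by omega))

end Summit.ResolutionOfSingularities.ResolutionOfSingularities.Theorems
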